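import Summits.BirchSwinnertonDyer.Rank1Residual.SmallImageMu.MuLeFineMu
import Summits.BirchSwinnertonDyer.Rank1Residual.SmallImageMu.TorsionPointFieldMu
import Summits.BirchSwinnertonDyer.Rank1Residual.SmallImageMu.TransportByName
import Summits.BirchSwinnertonDyer.Rank1Residual.SmallImageMu.EulerPrimitiveEdges
import Summits.BirchSwinnertonDyer.Rank1Residual.SmallImageMu.ConjARoad
import Summits.BirchSwinnertonDyer.Rank1Residual.SmallImageMu.KatoDivisibility
import Literature.NumberTheory.EllipticCurves.FineSelmerClassGroupCriterion
import Literature.NumberTheory.EllipticCurves.Kato2004.EulerSystemClasses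
import HarnessLib
import HarnessLib.Audit

/-!
# Kernel glue of ES-C6 (`MuLeFineMuOnClassX9`): (e1′) 19629 ∧ 19630 ⟹ ES-C6; (e1″) Greenberg-irr ⟹ ES-C6;
# (e2′) ES-C6 ∧ DESC-A ⟹ `μ = 0` / the node on X9; (e3) ES-C2 ∧ ES-C6 ⟹ the same; (e4) ES-C6 ⟹ DESC-C1;
# (e5) K1 ∧ ES-C6 ⟹ the same — theorems only

HONEST FRAMING (cell `bsd-f3-mu`).  THEOREMS ONLY, sorry-free; CONDITIONAL, credits nothing; every
statement is conditional on the open nodes in its hypotheses and/or on PUBLISHED named facts taken as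
binders (`hBCS` = BCS 2025 Thm 1.1.2 (a), `hmodP` = modularity, `hfine` = Kato's divisibility inputs with
the fine quotient (F1 family), `h34` = Coates–Sujatha 2005 Thm 3.4, `hT` = item 19629 `KatoMuTransfer`,
`hA` = item 19630 `AnalyticMuZeroOnClassX9`, `hG` = Greenberg's Conj. 1.11 irreducible form).  Ported from
the planner's checked `HOME/es/Sketch6.lean` (sha16 f03ae372678c37c1, rc 0, BC7 3/3 CLEAN by `-ref1`)
onto the filed names; the per-pair `μ = 0` consequences are carried to the node `KatoDivisibilityOnClassX9`
by the carrier engine `Rank1Residual.MuAlgZeroAt.katoDivisibilityAt` (`μ(X) = 0 ⟹ k ≤ 0 ⟹` divisibility).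

References: [Kato2004Asterisque] Thm. 12.4, 12.5, §17.13; [Ray2023] Conj. 5.3, Thm. 5.4, Cor. 5.5;
[CoatesSujatha2005] Thm. 3.4; [GreenbergLNM1716] Conj. 1.11; HOME MEMO-es.md §9, §26.
-/

-- the summit and its single problem are both named `BirchSwinnertonDyer` (registry layout D-0017)
set_option linter.dupNamespace false

noncomputable section

open scoped Classical

open WeierstrassCurve Field Literature.NumberTheory.EllipticCurves
  Literature.NumberTheory.GaloisRepresentations
  Literature.NumberTheory.EllipticCurves.ModularForms
  Literature.NumberTheory.EllipticCurves.Kato2004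
  Literature.NumberTheory.EllipticCurves.Kato2004.EulerSystemValues
  Summit.BirchSwinnertonDyer.BirchSwinnertonDyer.Rank1Residual
-- only the carriers from the Literature residual namespace (its census `ClassX9` must not shadow the
-- `μ`-version `Rank1ResidualX9Defs.ClassX9` used by the SmallImageMu nodes)
open Literature.NumberTheory.EllipticCurves.Rank1Residual (MuAnZeroAt MuAlgZeroAt FineMuZeroAt ConjAAt
  MuLeFineMuAt KatoDivisibilityAt isTorsion_of_bcs exists_fineSelmerDualData_finite_isTorsion
  ConjAAt.fineMuZeroAt)

namespace Summit.BirchSwinnertonDyer.Rank1Residual.SmallImageMu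

/-! ## §1 Sources of ES-C6 -/

/-- **(e1′) items 19629 (`KatoMuTransfer`) ∧ 19630 (`AnalyticMuZeroOnClassX9`) ⟹ ES-C6** — the census
witness: every certified row (`μ_an = 0`) satisfies ES-C6 modulo F1 (19629 is kernel-checked mod F1).
[cite: Kato2004Asterisque, Thm. 17.4 (p. 273) — the transfer's source] -/
theorem muLeFineMuOnClassX9_of_katoMuTransfer_of_analyticMuZero
    (hmodP : nonempty_modularParametrizationData) (hT : KatoMuTransfer)
    (hA : AnalyticMuZeroOnClassX9) : MuLeFineMuOnClassX9 :=
  fun _W _ _ _p _ hX9 => (muAlgZeroAt_of_classX9 hmodP hT hA hX9).muLeFineMuAt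

/-- **(e1″) Greenberg's Conj. 1.11 (irreducible form) ⟹ ES-C6** (cotorsion from BCS (a)).
[cite: GreenbergLNM1716, §1 Conj. 1.11 (p. 58)] -/
theorem muLeFineMuOnClassX9_of_greenbergMuConjectureIrreducible
    (hG : Summit.BirchSwinnertonDyer.Rank1Residual.GreenbergMuConjectureIrreducible)
    (hBCS : burungale_castella_skinner_charIdeal_eq_padicLFunction)
    (hmodP : nonempty_modularParametrizationData) : MuLeFineMuOnClassX9 :=
  fun _W _ _ _p _ hX9 =>
    (muAlgZeroAt_of_greenbergMuConjectureIrreducible_of_classX9 hG hBCS hmodP hX9).muLeFineMuAt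

/-! ## §2 Consequences of ES-C6: `μ = 0` at the pair, the node, DESC-C1 -/

section Consequences

variable {W : WeierstrassCurve ℚ} [W.IsElliptic] [W.IsGloballyMinimal] {p : ℕ} [Fact p.Prime]

/-- **(e2′) ES-C6 ∧ DESC-A (`ConjAOnClassX9`) ⟹ `μ^alg = 0` at every X9 pair** (mod F1-lite, BCS (a),
modularity — used only to produce a finitely generated torsion fine datum).  With (e1″): Greenberg-X9 ⟺
ConjA-X9 ∧ ES-C6 — Ray's Cor. 5.5 with Conj. 5.3 as the explicit conjunct.
[cite: Ray2023, Cor. 5.5 (arXiv:2308.06673 p. 4) — there conditional on Conj. 5.3]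
[cite: Kato2004Asterisque, Thm. 12.4 and §17.13] -/
theorem muAlgZeroAt_of_muLeFineMu_of_conjA_X9 (hmodP : nonempty_modularParametrizationData)
    (hfine : Kato2004.exists_divisibilityInputs_fineQuotient)
    (hBCS : burungale_castella_skinner_charIdeal_eq_padicLFunction)
    (h6 : MuLeFineMuOnClassX9) (hA : ConjAOnClassX9) (hX9 : ClassX9 W p) : MuAlgZeroAt W p := by
  obtain ⟨-, h5, hgood, hap, hirr, -⟩ := id hX9
  exact (h6 W p hX9).muAlgZeroAt_of_fineMuZeroAt (hA W p hX9).fineMuZeroAt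
    (exists_fineSelmerDualData_finite_isTorsion hmodP hfine hBCS h5 hgood hap hirr)

/-- **(e3) ES-C2 (`δ = 0`) ∧ ES-C6 (`e = 0`) ⟹ `μ^alg = 0` at every X9 pair** (mod F1, BCS (a),
modularity): the kernel core theorem turns `δ = 0` into `μ(X₀) = 0` (`EulerPrimitiveEdges` (b3)), and
`e = 0` lifts it to `μ(X) = 0`.  The Euler-system road to Greenberg on X9, its non-Euler input isolated
as ES-C6. [cite: Kato2004Asterisque, Thm. 12.5/12.6 (p. 222), §17.13] -/
theorem muAlgZeroAt_of_eulerPrimitive_of_muLeFineMu_X9 (hmodP : nonempty_modularParametrizationData)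
    (hfine : exists_divisibilityInputs_fineQuotient_zeta)
    (hBCS : burungale_castella_skinner_charIdeal_eq_padicLFunction)
    (h2 : EulerPrimitiveOnClassX9) (h6 : MuLeFineMuOnClassX9) (hX9 : ClassX9 W p) :
    MuAlgZeroAt W p := by
  obtain ⟨-, h5, hgood, hap, hirr, -⟩ := id hX9
  -- the span-clause F1 implies the plain F1 (instances supplied from the tree's `_holds` facts)
  have hfine' : Kato2004.exists_divisibilityInputs_fineQuotient := by
    intro W' _ _ p' _ _ N _ f κ γ hp hord hκ hγ hγ' hf I D Y
    haveI : Module.Free ℤ_[p'] (W'.tateModule p') := W'.module_free_tateModule_holds p'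
    haveI : Module.Finite ℤ_[p'] (W'.tateModule p') := W'.module_finite_tateModule_holds p'
    exact exists_divisibilityInputs_fineQuotient_of_zeta hfine W' p' f κ γ hp hord hκ hγ hγ' hf I D Y
  refine (h6 W p hX9).muAlgZeroAt_of_fineMuZeroAt ?_
    (exists_fineSelmerDualData_finite_isTorsion hmodP hfine' hBCS h5 hgood hap hirr)
  intro κ γ hκ hγ hγ' Y _ _
  exact fineMu_eq_zero_of_eulerPrimitiveOnClassX9 hmodP hfine h2 W p κ γ hX9 hκ hγ hγ' Y

/-- **(e5) K1 (`DivisionFieldClassicalMuZeroOnClassX9`) ∧ ES-C6 ⟹ `μ^alg = 0` at every X9 pair** (mod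
F1-lite, BCS (a), modularity, Coates–Sujatha Thm. 3.4) — the desc lens's dictionary «`μ = 0 ⟸ K1 ∧ K2`»
with K2 := ES-C6, kernel-checked. [cite: CoatesSujatha2005, Thm. 3.4 (§3)] [cite: Ray2023, Thm. 2 and Conj. 5.3] -/
theorem muAlgZeroAt_of_K1_of_muLeFineMu_X9 (hmodP : nonempty_modularParametrizationData)
    (hfine : Kato2004.exists_divisibilityInputs_fineQuotient)
    (hBCS : burungale_castella_skinner_charIdeal_eq_padicLFunction)
    (h34 : CoatesSujatha2005.thm34_fineSelmerDual_moduleFinite_of_classicalMuVanishes_divisionField)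
    (hK1 : DivisionFieldClassicalMuZeroOnClassX9) (h6 : MuLeFineMuOnClassX9) (hX9 : ClassX9 W p) :
    MuAlgZeroAt W p := by
  obtain ⟨-, h5, hgood, hap, hirr, -⟩ := id hX9
  have hA : ConjAAt W p := fun κ hκ => h34 W p (by omega) (hK1 W p hX9) κ hκ
  exact (h6 W p hX9).muAlgZeroAt_of_fineMuZeroAt hA.fineMuZeroAt
    (exists_fineSelmerDualData_finite_isTorsion hmodP hfine hBCS h5 hgood hap hirr)

end Consequences

/-- **(e4) ES-C6 ∧ Coates–Sujatha Thm. 3.4 ⟹ DESC-C1 `ClassicalMuSufficesOnClassX9`** (mod F1-lite,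
BCS (a), modularity): the classical `μ = 0` of `ℚ(E[p])` gives statement (A) at the pair by the TREE FACT
`CoatesSujatha2005.thm34_…`, hence `μ(X₀) = 0` (`ConjAAt.fineMuZeroAt`), and ES-C6 lifts it to
`μ(X) = 0`.  So the desc node's open content is contained in ES-C6.
[cite: CoatesSujatha2005, Thm. 3.4 (§3)] [cite: Ray2023, Thm. 2 (arXiv:2308.06673 p. 4) — there WITH Conj. 5.3] -/
theorem classicalMuSufficesOnClassX9_of_muLeFineMu (hmodP : nonempty_modularParametrizationData)
    (hfine : Kato2004.exists_divisibilityInputs_fineQuotient)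
    (hBCS : burungale_castella_skinner_charIdeal_eq_padicLFunction)
    (h34 : CoatesSujatha2005.thm34_fineSelmerDual_moduleFinite_of_classicalMuVanishes_divisionField)
    (h6 : MuLeFineMuOnClassX9) : ClassicalMuSufficesOnClassX9 := by
  intro W _ _ p _ hX9 hK1
  obtain ⟨-, h5, hgood, hap, hirr, -⟩ := id hX9
  have hA : ConjAAt W p := fun κ hκ => h34 W p (by omega) hK1 κ hκ
  exact (h6 W p hX9).muAlgZeroAt_of_fineMuZeroAt hA.fineMuZeroAt
    (exists_fineSelmerDualData_finite_isTorsion hmodP hfine hBCS h5 hgood hap hirr)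

/-! ## §3 The node from ES-C6: `μ(X) = 0` at the pair ⟹ Kato's integral divisibility at the pair -/

/-- **(e2′)⁺ ES-C6 ∧ DESC-A ⟹ the node `KatoDivisibilityOnClassX9`** (mod F1-lite, BCS (a), modularity):
per pair `μ(X) = 0` by (e2′), then `Rank1Residual.MuAlgZeroAt.katoDivisibilityAt` (`μ(X) = 0 ⟹ k ≤ 0`).
Compare `katoDivisibilityOnClassX9_of_conjAOnClassX9'` (DESC-A with S-W⁺ instead of ES-C6).
[cite: Ray2023, Cor. 5.5 (arXiv:2308.06673 p. 4)] [cite: BurungaleCastellaSkinner2025, Thm. 1.1.2 (a) (p. 2 of arXiv:2405.00270v2)] -/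
theorem katoDivisibilityOnClassX9_of_muLeFineMu_of_conjA (hmodP : nonempty_modularParametrizationData)
    (hfine : Kato2004.exists_divisibilityInputs_fineQuotient)
    (hBCS : burungale_castella_skinner_charIdeal_eq_padicLFunction)
    (h6 : MuLeFineMuOnClassX9) (hA : ConjAOnClassX9) : KatoDivisibilityOnClassX9 := by
  intro W _ _ p _ κ γ N _ f hX9 hκ hγ hγ' hf D
  obtain ⟨-, h5, hgood, hap, hirr, -⟩ := id hX9
  exact ((muAlgZeroAt_of_muLeFineMu_of_conjA_X9 hmodP hfine hBCS h6 hA hX9).katoDivisibilityAt hBCS h5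
    hgood hap hirr) κ γ f hκ hγ hγ' hf D

/-- **(e3)⁺ ES-C2 ∧ ES-C6 ⟹ the node `KatoDivisibilityOnClassX9`** (mod F1, BCS (a), modularity) — the
two chart coordinates `δ = 0`, `e = 0` give Kato's integral divisibility on X9 with no S-W⁺ input.
Compare `katoDivisibilityOnClassX9_of_eulerPrimitiveOnClassX9` (ES-C2 with S-W⁺ instead of ES-C6).
[cite: Kato2004Asterisque, Thm. 12.5/12.6 (p. 222), §17.13] [cite: BurungaleCastellaSkinner2025, Thm. 1.1.2 (a) (p. 2 of arXiv:2405.00270v2)] -/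
theorem katoDivisibilityOnClassX9_of_eulerPrimitive_of_muLeFineMu
    (hmodP : nonempty_modularParametrizationData) (hfine : exists_divisibilityInputs_fineQuotient_zeta)
    (hBCS : burungale_castella_skinner_charIdeal_eq_padicLFunction)
    (h2 : EulerPrimitiveOnClassX9) (h6 : MuLeFineMuOnClassX9) : KatoDivisibilityOnClassX9 := by
  intro W _ _ p _ κ γ N _ f hX9 hκ hγ hγ' hf D
  obtain ⟨-, h5, hgood, hap, hirr, -⟩ := id hX9
  exact ((muAlgZeroAt_of_eulerPrimitive_of_muLeFineMu_X9 hmodP hfine hBCS h2 h6 hX9).katoDivisibilityAt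
    hBCS h5 hgood hap hirr) κ γ f hκ hγ hγ' hf D

/-- **(e5)⁺ K1 ∧ ES-C6 ⟹ the node `KatoDivisibilityOnClassX9`** (mod F1-lite, BCS (a), modularity,
Coates–Sujatha Thm. 3.4). [cite: CoatesSujatha2005, Thm. 3.4 (§3)]
[cite: BurungaleCastellaSkinner2025, Thm. 1.1.2 (a) (p. 2 of arXiv:2405.00270v2)] -/
theorem katoDivisibilityOnClassX9_of_K1_of_muLeFineMu (hmodP : nonempty_modularParametrizationData)
    (hfine : Kato2004.exists_divisibilityInputs_fineQuotient)
    (hBCS : burungale_castella_skinner_charIdeal_eq_padicLFunction)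
    (h34 : CoatesSujatha2005.thm34_fineSelmerDual_moduleFinite_of_classicalMuVanishes_divisionField)
    (hK1 : DivisionFieldClassicalMuZeroOnClassX9) (h6 : MuLeFineMuOnClassX9) :
    KatoDivisibilityOnClassX9 := by
  intro W _ _ p _ κ γ N _ f hX9 hκ hγ hγ' hf D
  obtain ⟨-, h5, hgood, hap, hirr, -⟩ := id hX9
  exact ((muAlgZeroAt_of_K1_of_muLeFineMu_X9 hmodP hfine hBCS h34 hK1 h6 hX9).katoDivisibilityAt hBCS h5
    hgood hap hirr) κ γ f hκ hγ hγ' hf D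

end Summit.BirchSwinnertonDyer.Rank1Residual.SmallImageMu

end
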